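import Mathlib
import Summits.NavierStokesRegularity.NavierStokesRegularity.Theorems.WakeRatchetTailRatchetStallLimit
import HarnessLib

/-!
# `WakeRatchet.TailRatchet` (stmt-NavierStokesRegularity-21808) — door D4′, Cauchy-side bookkeeping:
# the firing order of consecutive shells, «active ⇒ recently fired», and the firing-gap bound

Def-free real-analysis lemmas for the intended inhabitant of the stall kill criterion
(`WakeRatchetStall.tailRatchet_false_of_persistentFiring`, `WakeRatchetStallLimit.tailRatchet_false_of_firingFrames`):
the frames of a non-negative dyadic blow-up solution recentred at its FIRING log-times.  In renormalised variables a
shell `v = W_{n+1}` of the scalar dyadic member obeys `v' = −v + Λ u² − Λ⁻¹ v z` (`u = W_n` feeds, `z = W_{n+2}`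
drains; Tao 2016 §1.2/§4 written in the self-similar variables of §6.4).  Recorded here, for ANY real `Λ > 0`:

* `exp_mul_le_of_feed_sq_le` (INVARIANT LEVEL / FIRING ORDER): while the feeding shell stays at `u² ≤ c²` on
  `[a, b)` and `v, z ≥ 0`, `e^σ v(σ) ≤ e^a v(a) + Λc²(e^σ − e^a)`; hence `v ≤ Λc²` on `[a,b]` if `v(a) ≤ Λc²`
  (`le_level_of_feed_sq_le`) and `v < Λc²` if `v(a) < Λc²` (`lt_level_of_feed_sq_le`).  With `Λc ≤ 1` this is
  `v ≤ c`: shell `n+1` cannot reach the firing level `c` before shell `n` does (one-shell Cauchy data: `v(a) = 0`).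
* `le_add_log_of_active` («ACTIVE ⇒ RECENTLY FIRED»): a post-firing decay bound `w ≤ D e^{−(σ−s)}` and an activity
  `w ≥ c₁ > 0` force `σ ≤ s + log(D/c₁)`.
* `firing_gap_le` (GAP BOUND): if firing log-times `s_n` are monotone and every log-time strictly between `s_j` and
  `s_{j+1}` is within `D₀` after the firing of some shell `n ≤ j`, then `s_{j+K} ≤ s_j + K·D₀`.

Together with the lower blow-up rate (some shell is active at level `1/Λ` at every log-time) these give uniform
firing windows for the recentred frames; the a-priori POST-FIRING BOUND (D) of the census (not in print) is the
only analytic input they take.  MODEL lattice bookkeeping only; nothing here concerns the Navier–Stokes equations;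
no item is closed.
-/

noncomputable section

set_option linter.dupNamespace false

namespace Summit.NavierStokesRegularity.NavierStokesRegularity.Theorems

namespace WakeRatchetFiringClock

open Set Filter Topology

/-! ## Firing order: the level `Λc²` is invariant for the next shell while the feeding shell is below `c` -/

/-- **Invariant level for the fed shell.**  If `v' = −v + Λu² − Λ⁻¹vz` on `[a,b)` with `v, z ≥ 0` on `[a,b]`,
`v` continuous on `[a,b]`, and the feed obeys `u² ≤ c²` on `[a,b)`, then
`e^σ v(σ) ≤ e^a v(a) + Λc² (e^σ − e^a)` for all `σ ∈ [a,b]`.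
[cite: Tao2016AveragedNS, §1.2 (dyadic model) and §4 Lemma 4.1 (4.8) in the self-similar variables of §6.4; elementary (monotonicity of `e^σ v − Λc² e^σ`)] -/
theorem exp_mul_le_of_feed_sq_le {Λ c a b : ℝ} (hΛ : 0 < Λ) {u v z : ℝ → ℝ}
    (hv : ∀ σ ∈ Ico a b, HasDerivAt v (-(v σ) + Λ * u σ ^ 2 - Λ⁻¹ * v σ * z σ) σ)
    (hvc : ContinuousOn v (Icc a b)) (hv0 : ∀ σ ∈ Icc a b, 0 ≤ v σ) (hz0 : ∀ σ ∈ Icc a b, 0 ≤ z σ)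
    (hu : ∀ σ ∈ Ico a b, u σ ^ 2 ≤ c ^ 2) :
    ∀ σ ∈ Icc a b, Real.exp σ * v σ ≤ Real.exp a * v a + Λ * c ^ 2 * (Real.exp σ - Real.exp a) := by
  -- `g σ = e^σ v σ − Λ c² e^σ` is antitone on `[a,b]`
  set g : ℝ → ℝ := fun σ => Real.exp σ * v σ - Λ * c ^ 2 * Real.exp σ with hg
  have hgc : ContinuousOn g (Icc a b) :=
    ((Real.continuous_exp.continuousOn).mul hvc).sub
      (continuousOn_const.mul Real.continuous_exp.continuousOn)
  have hderiv : ∀ σ ∈ interior (Icc a b), HasDerivWithinAt g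
      (Real.exp σ * (Λ * u σ ^ 2 - Λ⁻¹ * v σ * z σ - Λ * c ^ 2)) (interior (Icc a b)) σ := by
    intro σ hσ
    rw [interior_Icc] at hσ
    have hσ' : σ ∈ Ico a b := ⟨hσ.1.le, hσ.2⟩
    have h1 : HasDerivAt (fun x => Real.exp x * v x)
        (Real.exp σ * v σ + Real.exp σ * (-(v σ) + Λ * u σ ^ 2 - Λ⁻¹ * v σ * z σ)) σ :=
      (Real.hasDerivAt_exp σ).mul (hv σ hσ')
    have h2 : HasDerivAt (fun x => Λ * c ^ 2 * Real.exp x) (Λ * c ^ 2 * Real.exp σ) σ :=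
      (Real.hasDerivAt_exp σ).const_mul _
    have h3 := h1.sub h2
    refine (h3.congr_deriv ?_).hasDerivWithinAt
    ring
  have hnonpos : ∀ σ ∈ interior (Icc a b),
      Real.exp σ * (Λ * u σ ^ 2 - Λ⁻¹ * v σ * z σ - Λ * c ^ 2) ≤ 0 := by
    intro σ hσ
    rw [interior_Icc] at hσ
    have hσ' : σ ∈ Ico a b := ⟨hσ.1.le, hσ.2⟩
    have hσ'' : σ ∈ Icc a b := ⟨hσ.1.le, hσ.2.le⟩
    have h1 : Λ * u σ ^ 2 ≤ Λ * c ^ 2 := mul_le_mul_of_nonneg_left (hu σ hσ') hΛ.le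
    have h2 : 0 ≤ Λ⁻¹ * v σ * z σ := by
      have := hv0 σ hσ''; have := hz0 σ hσ''; positivity
    have h3 : Λ * u σ ^ 2 - Λ⁻¹ * v σ * z σ - Λ * c ^ 2 ≤ 0 := by linarith
    exact mul_nonpos_iff.2 (Or.inl ⟨(Real.exp_pos σ).le, h3⟩)
  have hanti : AntitoneOn g (Icc a b) :=
    antitoneOn_of_hasDerivWithinAt_nonpos (convex_Icc a b) hgc hderiv hnonpos
  intro σ hσ
  have hab : a ≤ b := hσ.1.trans hσ.2
  have h := hanti (left_mem_Icc.2 hab) hσ hσ.1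
  simp only [hg] at h
  linarith

/-- **Firing order, weak form.**  Under the hypotheses of `exp_mul_le_of_feed_sq_le`, if `v(a) ≤ Λc²` then
`v ≤ Λc²` on `[a,b]`; in particular with `Λc ≤ 1`, `c ≥ 0`: `v ≤ c` — the fed shell does not pass the level
of the feeding shell's ceiling.
[cite: Tao2016AveragedNS, §1.2, §4 Lemma 4.1 (4.8), §6.4; elementary] -/
theorem le_level_of_feed_sq_le {Λ c a b : ℝ} (hΛ : 0 < Λ) {u v z : ℝ → ℝ}
    (hv : ∀ σ ∈ Ico a b, HasDerivAt v (-(v σ) + Λ * u σ ^ 2 - Λ⁻¹ * v σ * z σ) σ)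
    (hvc : ContinuousOn v (Icc a b)) (hv0 : ∀ σ ∈ Icc a b, 0 ≤ v σ) (hz0 : ∀ σ ∈ Icc a b, 0 ≤ z σ)
    (hu : ∀ σ ∈ Ico a b, u σ ^ 2 ≤ c ^ 2) (hinit : v a ≤ Λ * c ^ 2) :
    ∀ σ ∈ Icc a b, v σ ≤ Λ * c ^ 2 := by
  intro σ hσ
  have h := exp_mul_le_of_feed_sq_le hΛ hv hvc hv0 hz0 hu σ hσ
  have hea : 0 < Real.exp a := Real.exp_pos a
  have hes : 0 < Real.exp σ := Real.exp_pos σ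
  have h2 : Real.exp σ * v σ ≤ Real.exp σ * (Λ * c ^ 2) := by nlinarith
  exact le_of_mul_le_mul_left h2 hes

/-- **Firing order, strict form** (one-shell Cauchy data: the fed shell starts at `v(a) = 0 < Λc²`): if
`v(a) < Λc²` then `v < Λc²` on `[a,b]`; with `Λc ≤ 1` the fed shell stays STRICTLY below the firing level `c`
as long as the feeding shell has not reached it.
[cite: Tao2016AveragedNS, §1.2, §4 Lemma 4.1 (4.8), §6.4; elementary] -/
theorem lt_level_of_feed_sq_le {Λ c a b : ℝ} (hΛ : 0 < Λ) {u v z : ℝ → ℝ}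
    (hv : ∀ σ ∈ Ico a b, HasDerivAt v (-(v σ) + Λ * u σ ^ 2 - Λ⁻¹ * v σ * z σ) σ)
    (hvc : ContinuousOn v (Icc a b)) (hv0 : ∀ σ ∈ Icc a b, 0 ≤ v σ) (hz0 : ∀ σ ∈ Icc a b, 0 ≤ z σ)
    (hu : ∀ σ ∈ Ico a b, u σ ^ 2 ≤ c ^ 2) (hinit : v a < Λ * c ^ 2) :
    ∀ σ ∈ Icc a b, v σ < Λ * c ^ 2 := by
  intro σ hσ
  have h := exp_mul_le_of_feed_sq_le hΛ hv hvc hv0 hz0 hu σ hσ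
  have hea : 0 < Real.exp a := Real.exp_pos a
  have hes : 0 < Real.exp σ := Real.exp_pos σ
  have h2 : Real.exp σ * v σ < Real.exp σ * (Λ * c ^ 2) := by nlinarith
  exact lt_of_mul_lt_mul_left h2 hes.le

/-- With `0 ≤ c` and `Λc ≤ 1` the invariant level `Λc²` is below the firing level `c`.
[cite: Tao2016AveragedNS, §4 (4.1) (the gain `Λ`); elementary] -/
theorem level_le_of_mul_le_one {Λ c : ℝ} (hc : 0 ≤ c) (hΛc : Λ * c ≤ 1) : Λ * c ^ 2 ≤ c := by
  nlinarith

/-! ## Active shells fired recently -/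

/-- **«Active ⇒ recently fired».**  A post-firing decay bound `w ≤ D e^{−(σ−s)}` and an activity `w ≥ c₁ > 0`
at log-time `σ` force `σ ≤ s + log(D/c₁)`.
[cite: Tao2016AveragedNS, §6.4 (self-similar log-time); elementary] -/
theorem le_add_log_of_active {w D c₁ σ s : ℝ} (hc₁ : 0 < c₁) (hact : c₁ ≤ w)
    (hdec : w ≤ D * Real.exp (-(σ - s))) : σ ≤ s + Real.log (D / c₁) := by
  have h1 : c₁ ≤ D * Real.exp (-(σ - s)) := hact.trans hdec
  have he : 0 < Real.exp (-(σ - s)) := Real.exp_pos _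
  have hD : 0 < D := by
    by_contra hD
    rw [not_lt] at hD
    have : D * Real.exp (-(σ - s)) ≤ 0 := mul_nonpos_iff.2 (Or.inr ⟨hD, he.le⟩)
    linarith
  -- `e^{σ - s} ≤ D / c₁`
  have h2 : Real.exp (σ - s) ≤ D / c₁ := by
    rw [le_div_iff₀ hc₁]
    have h3 : Real.exp (σ - s) * c₁ ≤ Real.exp (σ - s) * (D * Real.exp (-(σ - s))) :=
      mul_le_mul_of_nonneg_left h1 (Real.exp_pos _).le
    have h4 : Real.exp (σ - s) * (D * Real.exp (-(σ - s))) = D := by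
      rw [mul_left_comm, ← Real.exp_add, add_neg_cancel, Real.exp_zero, mul_one]
    linarith
  have h5 : σ - s ≤ Real.log (D / c₁) := by
    rw [← Real.exp_le_exp, Real.exp_log (div_pos hD hc₁)]
    exact h2
  linarith

/-! ## The firing-gap bound -/

/-- **One-step gap bound.**  If the firing log-times `s` are monotone and every log-time strictly between `s j`
and `s (j+1)` lies within `D₀ ≥ 0` after the firing of some shell `n ≤ j`, then `s (j+1) ≤ s j + D₀`.
[cite: Tao2016AveragedNS, §6.4 (self-similar log-time); elementary] -/
theorem firing_step_le {s : ℕ → ℝ} (hs : Monotone s) {D₀ : ℝ} (hD₀ : 0 ≤ D₀)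
    (hcover : ∀ (j : ℕ) (σ : ℝ), s j < σ → σ < s (j + 1) →
      ∃ n : ℕ, n ≤ j ∧ s n ≤ σ ∧ σ ≤ s n + D₀) (j : ℕ) :
    s (j + 1) ≤ s j + D₀ := by
  by_contra h
  rw [not_le] at h
  -- a log-time in the uncovered part of the gap
  set σ : ℝ := (s j + D₀ + s (j + 1)) / 2 with hσ
  have h1 : s j < σ := by rw [hσ]; linarith
  have h2 : σ < s (j + 1) := by rw [hσ]; linarith
  obtain ⟨n, hn, -, hσn⟩ := hcover j σ h1 h2
  have h3 : s n ≤ s j := hs hn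
  have h4 : s j + D₀ < σ := by rw [hσ]; linarith
  linarith

/-- **Firing-gap bound.**  Under the hypotheses of `firing_step_le`, `s (j + K) ≤ s j + K·D₀` for all `j, K`:
the recentred frames fire shell `k` inside the uniform window `[0, k·D₀]`.
[cite: Tao2016AveragedNS, §6.4 (self-similar log-time); elementary induction] -/
theorem firing_gap_le {s : ℕ → ℝ} (hs : Monotone s) {D₀ : ℝ} (hD₀ : 0 ≤ D₀)
    (hcover : ∀ (j : ℕ) (σ : ℝ), s j < σ → σ < s (j + 1) →
      ∃ n : ℕ, n ≤ j ∧ s n ≤ σ ∧ σ ≤ s n + D₀) :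
    ∀ j K : ℕ, s (j + K) ≤ s j + K * D₀ := by
  intro j K
  induction K with
  | zero => simp
  | succ K ih =>
    have h := firing_step_le hs hD₀ hcover (j + K)
    rw [show j + (K + 1) = j + K + 1 by ring]
    push_cast
    linarith

/-- **Firing windows of the recentred frames** (the hypothesis shape of
`WakeRatchetStallLimit.persistentFiring_of_limit`): with monotone firing log-times obeying the gap bound, in the
frame recentred at `s j` shell `k` fires inside `[0, k·D₀]`.
[cite: Tao2016AveragedNS, §6.4; elementary] -/
theorem frame_firing_window {s : ℕ → ℝ} (hs : Monotone s) {D₀ : ℝ} (hD₀ : 0 ≤ D₀)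
    (hcover : ∀ (j : ℕ) (σ : ℝ), s j < σ → σ < s (j + 1) →
      ∃ n : ℕ, n ≤ j ∧ s n ≤ σ ∧ σ ≤ s n + D₀) (j k : ℕ) :
    0 ≤ s (j + k) - s j ∧ s (j + k) - s j ≤ 0 + k * D₀ := by
  refine ⟨sub_nonneg.2 (hs (Nat.le_add_right j k)), ?_⟩
  have h := firing_gap_le hs hD₀ hcover j k
  linarith

/-- **The covering property from its three sources.**  If at every log-time after `s 0` some shell is active
at level `c₁ > 0` (lower blow-up rate), an active shell has already fired (`s n ≤ σ`; firing level `≤ c₁`),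
firing log-times are monotone (firing order), and fired shells decay like `D e^{−(σ − s n)}` (post-firing
bound (D)), then every log-time strictly between `s j` and `s (j+1)` lies within `log(D/c₁)` after the firing
of some shell `n ≤ j` — the hypothesis of `firing_step_le` / `firing_gap_le` with `D₀ = log(D/c₁)`.
[cite: Tao2016AveragedNS, §6.4 (self-similar log-time); elementary] -/
theorem cover_of_active {s : ℕ → ℝ} (hs : Monotone s) {w : ℕ → ℝ → ℝ} {c₁ D : ℝ} (hc₁ : 0 < c₁)
    (hactive : ∀ σ : ℝ, s 0 ≤ σ → ∃ n : ℕ, c₁ ≤ w n σ)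
    (hfired : ∀ (n : ℕ) (σ : ℝ), c₁ ≤ w n σ → s n ≤ σ)
    (hdecay : ∀ (n : ℕ) (σ : ℝ), s n ≤ σ → w n σ ≤ D * Real.exp (-(σ - s n))) :
    ∀ (j : ℕ) (σ : ℝ), s j < σ → σ < s (j + 1) →
      ∃ n : ℕ, n ≤ j ∧ s n ≤ σ ∧ σ ≤ s n + Real.log (D / c₁) := by
  intro j σ hjσ hσj
  have h0 : s 0 ≤ σ := (hs (Nat.zero_le j)).trans hjσ.le
  obtain ⟨n, hn⟩ := hactive σ h0
  have hsn : s n ≤ σ := hfired n σ hn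
  refine ⟨n, ?_, hsn, le_add_log_of_active hc₁ hn (hdecay n σ hsn)⟩
  by_contra hnj
  rw [not_le] at hnj
  have : s (j + 1) ≤ s n := hs (Nat.succ_le_of_lt hnj)
  linarith

/-! ## Composition with the stall kill criterion -/

open Literature.Analysis.FluidPDE Literature.Analysis.FluidPDE.TaoCascade
open Summit.NavierStokesRegularity.NavierStokesRegularity.Theses.WakeRatchet

/-- **Door D4′, limit side assembled.**  If on a fixed spread `R ≥ 1`, at arbitrarily small scale ratios, some
E₂(R) table carries frames `V j` (think: one blow-up solution renormalised and recentred at its firing log-times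
`s j`) converging continuously to a uniformly bounded admissible eternal solution, the firing log-times are
monotone with the covering property of `firing_step_le` (lower blow-up rate + firing order + «active ⇒ recently
fired»), and in frame `j` the forward shell `n₀ + k` sits at level `≥ c` at the recentred firing log-time
`s (j+k) − s j` (eventually in `j`), then `TailRatchet` fails.
[cite: Tao2016AveragedNS, §4 Thm. 4.2 (statement shape), §6.4; cell vocabulary] -/
theorem tailRatchet_false_of_clockedFrames {R : ℝ} (hR : 1 ≤ R)
    (hF : ∀ ε : ℝ, 0 < ε → ∃ ε₀ : ℝ, 0 < ε₀ ∧ ε₀ ≤ ε ∧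
      ∃ α : Fin 4 → Fin 4 → Fin 4 → ℤ × ℤ × ℤ → ℝ, InTableClass R α ∧
        ∃ (νh : ℝ) (W : ℤ → ℝ → Em 4) (V : ℕ → ℤ → ℝ → Em 4),
          IsEternalVisc ε₀ νh α W ∧ UniformBound W ∧
          (∀ (n : ℤ) (u : ℕ → ℝ) (σ : ℝ), Tendsto u atTop (𝓝 σ) →
            Tendsto (fun j => V j n (u j)) atTop (𝓝 (W n σ))) ∧
          ∃ (s : ℕ → ℝ) (D₀ c : ℝ) (n₀ : ℤ), Monotone s ∧ 0 ≤ D₀ ∧ 0 < c ∧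
            (∀ (j : ℕ) (σ : ℝ), s j < σ → σ < s (j + 1) →
              ∃ n : ℕ, n ≤ j ∧ s n ≤ σ ∧ σ ≤ s n + D₀) ∧
            ∀ k : ℕ, ∀ᶠ j in atTop, c ≤ ‖V j (n₀ + k) (s (j + k) - s j)‖) :
    ¬ TailRatchet := by
  refine WakeRatchetStallLimit.tailRatchet_false_of_firingFrames hR fun ε hε => ?_
  obtain ⟨ε₀, hε₀, hle, α, hα, νh, W, V, hW, hU, hconv, s, D₀, c, n₀, hs, hD₀, hc, hcover, hfire⟩ :=
    hF ε hε
  refine ⟨ε₀, hε₀, hle, α, hα, νh, W, V, hW, hU, hconv, c, hc, n₀, 0, fun k => k * D₀, fun k => ?_⟩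
  filter_upwards [hfire k] with j hj
  obtain ⟨h0, h1⟩ := frame_firing_window hs hD₀ hcover j k
  exact ⟨s (j + k) - s j, h0, h1, hj⟩

/-! ## The action of the fed shell is paid by the square-action of the feed (so (M) follows from (D)) -/

/-- **Fed shell + its action ≤ Λ × square-action of the feed.**  If `v' = −v + Λu² − Λ⁻¹vz` on `[a,b)` with
`v, z ≥ 0`, and `P' = v`, `Q' = u²` there (running action of the fed shell, running square-action of the feed;
all three continuous on `[a,b]`), then `v + P − ΛQ` is non-increasing on `[a,b]`:
`v(σ) + P(σ) − ΛQ(σ) ≤ v(a) + P(a) − ΛQ(a)`.  USE (door D4′): before its firing a shell of the one-shell dyadic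
Cauchy solution has `v(a) = P(a) = Q(a) = 0`, so its PRE-FIRING ACTION is at most `Λ∫u²`; splitting `∫u²` at the
feed's own firing (`u < c` before, `u ≤ D e^{−(σ−s)}` after, by the post-firing bound (D)) gives the recursion
`A_n ≤ (Λc)·A_{n−1} + ΛD²/2`, bounded uniformly in `n` when `Λc < 1`; with the post-firing part `≤ D` this is the
uniform per-shell action bound (M) of the census — a consequence of (D), not an independent input.
[cite: Tao2016AveragedNS, §1.2 (dyadic model), §4 Lemma 4.1 (4.8) in the self-similar variables of §6.4; elementary (monotonicity of `v + P − ΛQ`)] -/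
theorem fed_add_action_le {Λ a b : ℝ} (hΛ : 0 < Λ) {u v z P Q : ℝ → ℝ}
    (hv : ∀ σ ∈ Ico a b, HasDerivAt v (-(v σ) + Λ * u σ ^ 2 - Λ⁻¹ * v σ * z σ) σ)
    (hP : ∀ σ ∈ Ico a b, HasDerivAt P (v σ) σ) (hQ : ∀ σ ∈ Ico a b, HasDerivAt Q (u σ ^ 2) σ)
    (hvc : ContinuousOn v (Icc a b)) (hPc : ContinuousOn P (Icc a b)) (hQc : ContinuousOn Q (Icc a b))
    (hv0 : ∀ σ ∈ Icc a b, 0 ≤ v σ) (hz0 : ∀ σ ∈ Icc a b, 0 ≤ z σ) :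
    ∀ σ ∈ Icc a b, v σ + P σ - Λ * Q σ ≤ v a + P a - Λ * Q a := by
  set g : ℝ → ℝ := fun σ => v σ + P σ - Λ * Q σ with hg
  have hgc : ContinuousOn g (Icc a b) := (hvc.add hPc).sub (continuousOn_const.mul hQc)
  have hderiv : ∀ σ ∈ interior (Icc a b), HasDerivWithinAt g
      (-(Λ⁻¹ * v σ * z σ)) (interior (Icc a b)) σ := by
    intro σ hσ
    rw [interior_Icc] at hσ
    have hσ' : σ ∈ Ico a b := ⟨hσ.1.le, hσ.2⟩
    have h1 := ((hv σ hσ').add (hP σ hσ')).sub ((hQ σ hσ').const_mul Λ)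
    refine (h1.congr_deriv ?_).hasDerivWithinAt
    ring
  have hnonpos : ∀ σ ∈ interior (Icc a b), -(Λ⁻¹ * v σ * z σ) ≤ 0 := by
    intro σ hσ
    rw [interior_Icc] at hσ
    have hσ'' : σ ∈ Icc a b := ⟨hσ.1.le, hσ.2.le⟩
    have := hv0 σ hσ''; have := hz0 σ hσ''
    have : 0 ≤ Λ⁻¹ * v σ * z σ := by positivity
    linarith
  have hanti : AntitoneOn g (Icc a b) :=
    antitoneOn_of_hasDerivWithinAt_nonpos (convex_Icc a b) hgc hderiv hnonpos
  intro σ hσ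
  have hab : a ≤ b := hσ.1.trans hσ.2
  have h := hanti (left_mem_Icc.2 hab) hσ hσ.1
  simpa only [hg] using h

/-- **Pre-firing action of a shell born empty.**  With `v(a) = P(a) = Q(a) = 0` (one-shell Cauchy data seen from
a later shell): `v(σ) + ∫_a^σ v ≤ Λ ∫_a^σ u²` on `[a,b]`, in the antiderivative form `v σ + P σ ≤ Λ Q σ`.
[cite: Tao2016AveragedNS, §1.2, §4 Lemma 4.1 (4.8), §6.4; elementary] -/
theorem preFiring_action_le {Λ a b : ℝ} (hΛ : 0 < Λ) {u v z P Q : ℝ → ℝ}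
    (hv : ∀ σ ∈ Ico a b, HasDerivAt v (-(v σ) + Λ * u σ ^ 2 - Λ⁻¹ * v σ * z σ) σ)
    (hP : ∀ σ ∈ Ico a b, HasDerivAt P (v σ) σ) (hQ : ∀ σ ∈ Ico a b, HasDerivAt Q (u σ ^ 2) σ)
    (hvc : ContinuousOn v (Icc a b)) (hPc : ContinuousOn P (Icc a b)) (hQc : ContinuousOn Q (Icc a b))
    (hv0 : ∀ σ ∈ Icc a b, 0 ≤ v σ) (hz0 : ∀ σ ∈ Icc a b, 0 ≤ z σ)
    (hva : v a = 0) (hPa : P a = 0) (hQa : Q a = 0) :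
    ∀ σ ∈ Icc a b, v σ + P σ ≤ Λ * Q σ := by
  intro σ hσ
  have h := fed_add_action_le hΛ hv hP hQ hvc hPc hQc hv0 hz0 σ hσ
  rw [hva, hPa, hQa, mul_zero, zero_add, sub_zero] at h
  linarith

/-- **The action recursion, arithmetic form.**  If non-negative pre-firing actions obey
`A (n+1) ≤ θ·A n + B` with `0 ≤ θ < 1`, then `A n ≤ A 0 + B/(1 − θ)` for all `n` (uniform per-shell action).
[folklore] -/
theorem action_recursion_bound {A : ℕ → ℝ} {θ B : ℝ} (hθ0 : 0 ≤ θ) (hθ1 : θ < 1) (hB : 0 ≤ B)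
    (hA0 : ∀ n, 0 ≤ A n) (hrec : ∀ n, A (n + 1) ≤ θ * A n + B) :
    ∀ n, A n ≤ A 0 + B / (1 - θ) := by
  have h1θ : 0 < 1 - θ := by linarith
  have hBd : 0 ≤ B / (1 - θ) := div_nonneg hB h1θ.le
  -- the level `L = max (A 0) (B/(1-θ))` is invariant: `θ L + B ≤ L` as soon as `L ≥ B/(1-θ)`
  set L : ℝ := max (A 0) (B / (1 - θ)) with hL
  have hLB : B / (1 - θ) ≤ L := le_max_right _ _
  have hkey : θ * L + B ≤ L := by
    have : B ≤ (1 - θ) * L := by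
      calc B = (1 - θ) * (B / (1 - θ)) := by field_simp
        _ ≤ (1 - θ) * L := mul_le_mul_of_nonneg_left hLB h1θ.le
    linarith
  have hind : ∀ n, A n ≤ L := by
    intro n
    induction n with
    | zero => exact le_max_left _ _
    | succ n ih =>
      calc A (n + 1) ≤ θ * A n + B := hrec n
        _ ≤ θ * L + B := by nlinarith
        _ ≤ L := hkey
  intro n
  calc A n ≤ L := hind n
    _ ≤ A 0 + B / (1 - θ) := max_le (by linarith) (by linarith [hA0 0])

end WakeRatchetFiringClock

end Summit.NavierStokesRegularity.NavierStokesRegularity.Theorems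

end
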